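import Mathlib.Data.Nat.Log
import Literature.Computability.Complexity.Classes
import Literature.Computability.Complexity.Nondeterministic
import Literature.Computability.Complexity.Randomized
import Literature.Computability.MetaComplexity.DistProblems
import Literature.Computability.MetaComplexity.HeuristicClasses
import HarnessLib

-- provenance: harness21/H21/H21/Statements/CryptoFoundations/AverageCase.lean @ b87e6c8 (interim HEAD d8f2665); M5 mechanical rewrite
/-!
# Crypto foundations: average-case complexity statements

Family `CryptoFoundations`, trunk `CplxMeta` (G14), outline §3 (`AverageCase.lean`).
Target statements **crypto-foundations.S14** (definition role: distributional problems,
samplable ensembles, `DistNP`, `AvgP`/`HeurP`/errorless heuristics — the definitions live in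
`Literature.Prelude.CplxMeta.DistProblems`; here we record the characterisation/sanity theorems
carrying the id) and **crypto-foundations.S16** (Hirahara's worst-case-to-average-case
connection `UP ⊄ DTIME(2^{O(n / log n)}) ⇒ DistNP ⊄ AvgP`).

## Contents

* `mem_DistNP_iff` — `Q ∈ DistNP ↔ Q.lang ∈ NP ∧ Q.dist.IsPolySamplable` (by `Iff.rfl`);
* `distClass_NP_uniform_subset_DistNP` — `(NP, U) ⊆ DistNP` (from `uniformEnsemble_mem_PSamp`);
* `DistNP_inter_AvgP_subset_HeurP` — `DistNP ∩ AvgP ⊆ HeurP` (from the prelude's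
  `AvgP_subset_HeurP`; the distinct name avoids a clash under `open Literature.CplxMeta`);
* `mem_AvgP_iff_mem_AvgPLevin_of_mem_DistNP` — on `DistNP`, Bogdanov–Trevisan's errorless
  heuristic schemes and Levin's average polynomial time agree (from the prelude's
  `mem_AvgP_iff_mem_AvgPLevin` and `Ensemble.IsPolySamplable.hasPolyLength`; this is *not*
  hypothesis-free, see the prelude docstring);
* `hirahara_UP_DistNP` — Hirahara STOC 2021, Thm. 1.6 (`sorry`).

## Design choices

* `DTIME(2^{O(n / log n)})` is rendered as `⋃ c, DTIME (fun n => 2 ^ (c * n / Nat.log 2 n))`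
  with Mathlib's `Nat.log` and natural-number division. For `n ≤ 1`, `Nat.log 2 n = 0` and
  `Nat` division by `0` returns `0`, so the time bound is `2 ^ 0 = 1` there; this affects only
  the two lengths `0, 1`, which the additive constant in H21's `DTIME`
  (`c' * t n + c'`) absorbs, so the class is the intended one. Likewise the summand `c = 0`
  contributes the (harmless, smaller) class `DTIME 1` to the union.
* No new definitions are introduced; everything is stated over the prelude's `DistProblem`,
  `DistNP`, `AvgP`, `HeurP`, `AvgPLevin`, `distClass`, `uniformEnsemble`, and G01's `NP`, `UP`,
  `DTIME`.

Mathlib anchors used: `Nat.log`, `Set` lattice operations. Mathlib has no average-case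
complexity classes (grep: no `DistNP`, `AvgP`, `HeurP`, `Samplable`).

## References

* L. Levin, *Average case complete problems*, SIAM J. Comput. 15 (1986), 285–286.
* A. Bogdanov, L. Trevisan, *Average-Case Complexity*, Found. Trends TCS 2 (2006), Ch. 2–3.
* R. Impagliazzo, *A personal view of average-case complexity*, CCC 1995.
* S. Hirahara, *Average-case hardness of NP from exponential worst-case hardness assumptions*,
  STOC 2021, Thm. 1.6.
-/

namespace Literature.Computability.Cryptography

open _root_.Computability Complexity Complexity.Nondeterministic MetaComplexity

/-! ### crypto-foundations.S14: distributional problems, `DistNP`, `AvgP`, `HeurP` -/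

/-- **crypto-foundations.S14** (definition role: `DistNP`). A distributional problem
`Q = (L, D)` lies in `DistNP = (NP, PSamp)` iff its language is in `NP` and its ensemble is
polynomial-time samplable. [Bogdanov–Trevisan 2006, Def. 2.1 and Def. 2.3; Impagliazzo 1995,
§2; Levin 1986] [cite: BogdanovTrevisan2006, Def. 2.1 and Def. 2.3] -/
theorem mem_DistNP_iff (Q : DistProblem) :
    Q ∈ DistNP ↔ Q.lang ∈ NP ∧ Q.dist.IsPolySamplable :=
  Iff.rfl

/-- **crypto-foundations.S14** (definition role: samplable ensembles). The distributional class
`(NP, U)` of `NP` languages with the uniform ensemble is contained in `DistNP`, since the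
uniform ensemble is polynomial-time samplable. [Bogdanov–Trevisan 2006, §2.1 (Def. 2.1,
example) and Def. 2.3] [cite: BogdanovTrevisan2006, §2.1 (Def. 2.1  example] -/
def distClass_NP_uniform_subset_DistNP : Prop :=
  distClass NP {uniformEnsemble} ⊆ DistNP

/- interim proof relied on results that are now named facts (D-0014); demoted to a fact by the M5 import, proof preserved:
:= by
  refine distClass_mono subset_rfl ?_
  rintro D rfl
  exact uniformEnsemble_mem_PSamp
-/

/-- **crypto-foundations.S14** (definition role: errorless heuristics vs heuristics). Every
`DistNP` problem with an errorless heuristic scheme has a heuristic scheme: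
`DistNP ∩ AvgP ⊆ HeurP` (indeed `AvgP ⊆ HeurP`, prelude `AvgP_subset_HeurP`: answer `0`
instead of `⊥`). [Bogdanov–Trevisan 2006, §2.2 (Def. 2.4, Def. 2.9 and the remark after
Def. 2.10); Impagliazzo 1995, §2] [cite: BogdanovTrevisan2006, §2.2 (Def. 2.4  Def. 2.9 and the remark] -/
def DistNP_inter_AvgP_subset_HeurP : Prop :=
  DistNP ∩ AvgP ⊆ HeurP

/- interim proof relied on results that are now named facts (D-0014); demoted to a fact by the M5 import, proof preserved:
:=
  fun _ hQ => AvgP_subset_HeurP hQ.2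
-/

/-- **crypto-foundations.S14** (definition role: `AvgP`). On `DistNP`, Bogdanov–Trevisan's
definition of `AvgP` by errorless heuristic schemes coincides with Levin's original definition
by average polynomial running time (`AvgPLevin`, `𝔼_{x ∼ Dₙ}[t(x,n)^ε] = O(n)`). The
hypothesis `Q ∈ DistNP` supplies `Q.dist.HasPolyLength` (via
`Ensemble.IsPolySamplable.hasPolyLength`), under which the prelude's
`mem_AvgP_iff_mem_AvgPLevin` applies; the equivalence is *not* hypothesis-free (see that
lemma's docstring). [Bogdanov–Trevisan 2006, Def. 2.2, Def. 2.4, Prop. 2.6; Impagliazzo 1995,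
§2.2; Levin 1986] [cite: BogdanovTrevisan2006, Def. 2.2  Def. 2.4  Prop. 2.6] -/
def mem_AvgP_iff_mem_AvgPLevin_of_mem_DistNP : Prop :=
  ∀ {Q : DistProblem} (h : Q ∈ DistNP),
    Q ∈ AvgP ↔ Q ∈ AvgPLevin

/- interim proof relied on results that are now named facts (D-0014); demoted to a fact by the M5 import, proof preserved:
:=
  mem_AvgP_iff_mem_AvgPLevin (Ensemble.IsPolySamplable.hasPolyLength h.2)
-/

/-! ### crypto-foundations.S16: Hirahara's theorem -/

/-- **crypto-foundations.S16** (Hirahara STOC 2021, Thm. 1.6). If `UP ⊄ DTIME(2^{O(n / log n)})`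
then `DistNP ⊄ AvgP`: exponential worst-case hardness of unambiguous nondeterministic
polynomial time implies that `DistNP` is not solvable by errorless heuristic schemes.

`DTIME(2^{O(n / log n)})` is `⋃ c, DTIME (fun n => 2 ^ (c * n / Nat.log 2 n))` (Mathlib
`Nat.log`, `ℕ`-division). For `n ≤ 1` we have `Nat.log 2 n = 0`, whence `c * n / 0 = 0` and the
bound is `2 ^ 0 = 1`; this concerns only the lengths `0` and `1` and is absorbed by the additive
constant of H21's `DTIME t = {L | ∃ c', L ∈ TimeClass (c' * t n + c')}`, so it is immaterial.
[S. Hirahara, *Average-case hardness of NP from exponential worst-case hardness assumptions*,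
STOC 2021, Thm. 1.6] [cite: STOC2021, Thm. 1.6] -/
def hirahara_UP_DistNP : Prop :=
  ∀ (h : ¬ UP ⊆ ⋃ c : ℕ, DTIME (fun n => 2 ^ (c * n / Nat.log 2 n))),
    ¬ DistNP ⊆ AvgP

end Literature.Computability.Cryptography
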